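import Literature.NumberTheory.LFunctions.WeilTwoPrimeCertificateDeflated
import Literature.NumberTheory.LFunctions.WeilTwoPrimeCertificateOK
import HarnessLib

/-!
# The deflated two-prime certificate from a VALID cell chain, and its odd-sector form

Topic `Literature/NumberTheory/LFunctions`; companion of `WeilTwoPrimeCertificateDeflated.lean` (the rank-one augmented
moment certificate `WeilCert23.checkR`, soundness `WeilCert23.weilTwoPrimeQuadratic_rankOne_bound_of_checkR`:
`β ‖g‖₂² ≤ E₂₃(g) + Σ_i μ_i |Σ_k ĉ_{ik} M_k(g)|²` on `C(b)`) and of `WeilTwoPrimeCertificateOK.lean` (soundness of the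
plain format from the SEMANTIC chain hypothesis `CellsOK₂₃` instead of the fixed-scale integer check `checkCells₂₃`).

Two variants needed by the deflated Temple / Lehmann–Maehly L-sides of the parity ladder beyond `log 2`
(`Summits/RiemannHypothesis/RiemannHypothesis/Theorems/GroundBartaEvenWinsBeyondArchDeflationRitz.lean`, hypothesis `hcert`):

* `WeilCert23.checkROK` / **`WeilCert23.weilTwoPrimeQuadratic_rankOne_bound_of_cellsOK`** — `checkR` without the cell
  check; the chain enters as `CellsOK₂₃ wL T cells`, so chains certified by the multi-precision checker
  (`WeilTwoPrimeCellsMP.lean`; e.g. `cellsOK_weilTwoPrimeCellsT120`, level `wL ≈ 1.8455`, the only landed chain with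
  `κ = wL − log π − … ≈ 0.70` large enough for a complement level `β` of order one) can be used;
* `WeilCert23.checkR1OK` / **`WeilCert23.weilTwoPrimeQuadratic_rankOne_bound_odd_of_cellsOK`** — the ODD-SECTOR form: only
  the odd block of `P_r + Σ μ ĉ ĉᵀ` is checked and the conclusion is stated for odd tests (`g(−x) = −g(x)`), whose even
  moments vanish (`weilMoment_even_of_odd`), so the even block contributes nothing (`WeilCert.core_nonnegR_odd`, the
  rank-one analogue of `WeilCert.core_nonnegK_odd`).

All proved; no named facts.

## References
* H. Yoshida, *On Hermitian forms attached to zeta functions*, Adv. Stud. Pure Math. 21 (1992), §2, §6, Thm 1. [Yoshida1992]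
* A. Weinstein, W. Stenger, *Methods of Intermediate Problems for Eigenvalues* (1972), Ch. 5 §9. [WeinsteinStenger1972]
-/

noncomputable section

open Complex Finset MeasureTheory Set Filter
open scoped Real Topology ComplexConjugate BigOperators

namespace Literature.NumberTheory.LFunctions

open Literature.Analysis.ValidatedNumerics.Numerics
open Literature.Analysis.SpecialFunctions

/-! ## The algebraic core on the odd block, with rank-one terms -/

namespace WeilCert

variable {c : WeilCert}

/-- **The algebraic core on the odd block for an arbitrary parity-diagonal `P`.** If the even entries of `M` vanish,
then with `N + 1 = 2 nb` and only the ODD block of `P` checked (`checkBlockP P κ 1`), the reduced form plus `κ ×` the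
Bessel expression is `Re y₁* S'₁ y₁ ≥ 0` (the even block contributes nothing: `y₀ = 0`, `u(2i) = 0`). [folklore] -/
theorem core_nonnegP_odd {P : ℕ → ℕ → ℚ} {κ : ℚ} (hN : c.N + 1 = 2 * c.nb)
    (hPcross : ∀ {k l : ℕ}, k % 2 ≠ l % 2 → P k l = 0) (hb1 : c.checkBlockP P κ 1 = true)
    (M : ℕ → ℂ) (hM : ∀ i, M (2 * i) = 0) :
    0 ≤ (∑ k ∈ range (c.N + 1), ∑ l ∈ range (c.N + 1),
        (P k l : ℝ) * (conj (M k) * M l).re) +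
      (κ : ℝ) *
        (2 * (∑ k ∈ range (c.N + 1), conj (c.uVec M k) * M k).re -
          (∑ k ∈ range (c.N + 1), ∑ l ∈ range (c.N + 1),
            conj (c.uVec M k) * c.uVec M l * (gramH (c.a0 : ℝ) k l : ℂ)).re) := by
  set a : ℝ := (c.a0 : ℝ) with ha_def
  have hDC1 : c.checkDC 1 = true := by
    unfold WeilCert.checkBlockP at hb1; rw [Bool.and_eq_true] at hb1; exact hb1.1
  -- the even coordinates vanish
  have hy0 : ∀ j, c.yVec M 0 j = 0 := fun j ↦ by
    unfold WeilCert.yVec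
    exact Finset.sum_eq_zero fun i _ ↦ by rw [add_zero, hM, mul_zero]
  have hu0 : ∀ i, c.uVec M (2 * i) = 0 := fun i ↦ by
    have h := WeilCert.uVec_block (c := c) M 0 i (by norm_num)
    rw [add_zero] at h
    rw [h]
    exact Finset.sum_eq_zero fun j _ ↦ by rw [hy0, mul_zero]
  -- rewrite everything as the real part of one complex expression
  have key : (∑ k ∈ range (c.N + 1), ∑ l ∈ range (c.N + 1),
        (P k l : ℝ) * (conj (M k) * M l).re) +
      (κ : ℝ) *
        (2 * (∑ k ∈ range (c.N + 1), conj (c.uVec M k) * M k).re -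
          (∑ k ∈ range (c.N + 1), ∑ l ∈ range (c.N + 1),
            conj (c.uVec M k) * c.uVec M l * (gramH a k l : ℂ)).re) =
      ((∑ k ∈ range (c.N + 1), ∑ l ∈ range (c.N + 1),
          (P k l : ℂ) * (conj (M k) * M l)) +
        (κ : ℂ) *
          (2 * ∑ k ∈ range (c.N + 1), conj (c.uVec M k) * M k -
            ∑ k ∈ range (c.N + 1), ∑ l ∈ range (c.N + 1),
              conj (c.uVec M k) * c.uVec M l * (gramH a k l : ℂ))).re := by
    have e1 : (∑ k ∈ range (c.N + 1), ∑ l ∈ range (c.N + 1),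
        (P k l : ℂ) * (conj (M k) * M l)).re =
        ∑ k ∈ range (c.N + 1), ∑ l ∈ range (c.N + 1), (P k l : ℝ) * (conj (M k) * M l).re := by
      rw [Complex.re_sum]
      refine Finset.sum_congr rfl fun k _ ↦ ?_
      rw [Complex.re_sum]
      refine Finset.sum_congr rfl fun l _ ↦ ?_
      rw [show ((P k l : ℚ) : ℂ) = (((P k l : ℚ) : ℝ) : ℂ) by norm_cast,
        Complex.re_ofReal_mul]
    have e2 : ∀ (κ : ℚ) (X Y : ℂ), ((κ : ℂ) * (2 * X - Y)).re = (κ : ℝ) * (2 * X.re - Y.re) := by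
      intro κ X Y
      rw [show ((κ : ℚ) : ℂ) = (((κ : ℚ) : ℝ) : ℂ) by norm_cast, Complex.re_ofReal_mul]
      congr 1
      simp [Complex.mul_re]
    rw [Complex.add_re, e1, e2]
  rw [key]
  -- parity split
  have hH : ∀ k l, k % 2 ≠ l % 2 → (gramH a k l : ℂ) = 0 := by
    intro k l hkl
    have hodd : Odd (k + l) := by
      rcases Nat.even_or_odd k with hk | hk <;> rcases Nat.even_or_odd l with hl | hl
      · exact absurd (by rw [Nat.even_iff.1 hk, Nat.even_iff.1 hl]) hkl
      · exact hk.add_odd hl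
      · exact hk.add_even hl
      · exact absurd (by rw [Nat.odd_iff.1 hk, Nat.odd_iff.1 hl]) hkl
    rw [gramH, hodd.neg_one_pow]
    simp
  rw [hN, WeilAlg.sum_sum_range_two_mul c.nb _ (fun k l hkl ↦ by
      rw [hPcross hkl]; simp),
    WeilAlg.sum_range_two_mul c.nb,
    WeilAlg.sum_sum_range_two_mul c.nb _ (fun k l hkl ↦ by rw [hH k l hkl]; simp)]
  -- the Gram entries on the odd block
  have hG1 : ∀ i i', (gramH a (2 * i + 1) (2 * i' + 1) : ℂ) = (c.hBlkQ 1 i i' : ℂ) := by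
    intro i i'
    have hev : Even (2 * i + 1 + (2 * i' + 1)) := ⟨i + i' + 1, by ring⟩
    rw [gramH, hev.neg_one_pow, WeilCert.hBlkQ, ha_def]
    push_cast
    ring
  simp_rw [hG1]
  have e1 := WeilCert.block_identityP (c := c) (P := P) κ (p := 1) (by norm_num) hDC1 M
  -- the even block vanishes
  simp only [hM, hu0, map_zero, zero_mul, mul_zero, Finset.sum_const_zero, zero_add]
  rw [e1]
  exact WeilAlg.re_herm_nonneg c.nb _ (fun x ↦ WeilCert.spFunP_quad_nonneg hb1 x) _

/-- **The algebraic core with rank-one terms, odd block only**: if the even moments vanish and the ODD parity block of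
`P_r + Σ μ ĉ ĉᵀ` passes the check with Bessel weight `κ`, then
`Σ P_r(k,l) Re(M̄_k M_l) + κ·Bessel(M) + Σ_i μ_i |Σ_k ĉ_{ik} M_k|² ≥ 0`. [folklore] -/
theorem core_nonnegR_odd {nu : List ℚ} {κ : ℚ} (R : List (ℚ × ℕ × List ℚ)) (hN : c.N + 1 = 2 * c.nb)
    (hb1 : c.checkBlockP (fun k l ↦ c.prQ nu k l + rankOneQ R k l) κ 1 = true)
    (M : ℕ → ℂ) (hM : ∀ i, M (2 * i) = 0) :
    0 ≤ (∑ k ∈ range (c.N + 1), ∑ l ∈ range (c.N + 1), (c.prQ nu k l : ℝ) * (conj (M k) * M l).re) +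
      (κ : ℝ) *
        (2 * (∑ k ∈ range (c.N + 1), conj (c.uVec M k) * M k).re -
          (∑ k ∈ range (c.N + 1), ∑ l ∈ range (c.N + 1),
            conj (c.uVec M k) * c.uVec M l * (gramH (c.a0 : ℝ) k l : ℂ)).re) +
      (R.map fun r ↦ (r.1 : ℝ) * ‖∑ k ∈ range (c.N + 1), ((maskV r k : ℚ) : ℂ) * M k‖ ^ 2).sum := by
  have hcross : ∀ {k l : ℕ}, k % 2 ≠ l % 2 → c.prQ nu k l + rankOneQ R k l = 0 := fun hkl ↦ by
    rw [c.prQ_cross nu hkl, rankOneQ_cross R hkl, add_zero]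
  have h := core_nonnegP_odd (P := fun k l ↦ c.prQ nu k l + rankOneQ R k l) hN hcross hb1 M hM
  have e : ∑ k ∈ range (c.N + 1), ∑ l ∈ range (c.N + 1),
      (((fun k l ↦ c.prQ nu k l + rankOneQ R k l) k l : ℚ) : ℝ) * (conj (M k) * M l).re =
      (∑ k ∈ range (c.N + 1), ∑ l ∈ range (c.N + 1), (c.prQ nu k l : ℝ) * (conj (M k) * M l).re) +
        ∑ k ∈ range (c.N + 1), ∑ l ∈ range (c.N + 1), ((rankOneQ R k l : ℚ) : ℝ) * (conj (M k) * M l).re := by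
    rw [← Finset.sum_add_distrib]
    refine Finset.sum_congr rfl fun k _ ↦ ?_
    rw [← Finset.sum_add_distrib]
    refine Finset.sum_congr rfl fun l _ ↦ ?_
    push_cast
    ring
  rw [e, rankOneQ_quad] at h
  linarith

end WeilCert

/-! ## The checkers without the cell check, and their soundness from `CellsOK₂₃` -/

namespace WeilCert23

variable (c : WeilCert23)

/-- **The rank-one augmented checker without the cell check** (the chain is supplied as `CellsOK₂₃`): scalars, moment
table, `β ≤ κ`, and both parity blocks of `P_r + Σ μ ĉ ĉᵀ` with Bessel weight `κ − β`. [folklore] -/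
def checkROK (β : ℚ) (R : List (ℚ × ℕ × List ℚ)) : Bool :=
  c.checkScalars && c.checkNu && decide (β ≤ c.kappaQ) &&
    c.base.checkBlockP (fun k l ↦ c.base.prQ c.nuTab k l + rankOneQ R k l) (c.kappaQ - β) 0 &&
    c.base.checkBlockP (fun k l ↦ c.base.prQ c.nuTab k l + rankOneQ R k l) (c.kappaQ - β) 1

/-- **The ODD-SECTOR rank-one augmented checker without the cell check**: scalars, moment table, `β ≤ κ`, and the ODD
parity block only. [folklore] -/
def checkR1OK (β : ℚ) (R : List (ℚ × ℕ × List ℚ)) : Bool :=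
  c.checkScalars && c.checkNu && decide (β ≤ c.kappaQ) &&
    c.base.checkBlockP (fun k l ↦ c.base.prQ c.nuTab k l + rankOneQ R k l) (c.kappaQ - β) 1

variable {c}

/-- Unpacking `checkROK`. [folklore] -/
theorem checkROK_spec {β : ℚ} {R : List (ℚ × ℕ × List ℚ)} (h : c.checkROK β R = true) :
    c.checkScalars = true ∧ c.checkNu = true ∧ β ≤ c.kappaQ ∧
      c.base.checkBlockP (fun k l ↦ c.base.prQ c.nuTab k l + rankOneQ R k l) (c.kappaQ - β) 0 = true ∧
      c.base.checkBlockP (fun k l ↦ c.base.prQ c.nuTab k l + rankOneQ R k l) (c.kappaQ - β) 1 = true := by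
  unfold checkROK at h
  simp only [Bool.and_eq_true, decide_eq_true_eq] at h
  exact ⟨h.1.1.1.1, h.1.1.1.2, h.1.1.2, h.1.2, h.2⟩

/-- Unpacking `checkR1OK`. [folklore] -/
theorem checkR1OK_spec {β : ℚ} {R : List (ℚ × ℕ × List ℚ)} (h : c.checkR1OK β R = true) :
    c.checkScalars = true ∧ c.checkNu = true ∧ β ≤ c.kappaQ ∧
      c.base.checkBlockP (fun k l ↦ c.base.prQ c.nuTab k l + rankOneQ R k l) (c.kappaQ - β) 1 = true := by
  unfold checkR1OK at h
  simp only [Bool.and_eq_true, decide_eq_true_eq] at h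
  exact ⟨h.1.1.1, h.1.1.2, h.1.2, h.2⟩

/-- **Soundness of the rank-one augmented two-prime certificate from a valid chain.** If the chain is valid
(`CellsOK₂₃`) and `c.checkROK β R = true` then for every test function `g` supported in `[-b, b]`:
`β ‖g‖₂² ≤ E₂₃(g) + Σ_{(μ,q,c) ∈ R} μ |Σ_{k ≤ N} ĉ_k M_k(g)|²`, `M_k(g) = ∫ g(x)(x/a₀)^k dx`.
[cite: Yoshida1992, Thm 1 (moment certificates)] -/
theorem weilTwoPrimeQuadratic_rankOne_bound_of_cellsOK {β : ℚ} {R : List (ℚ × ℕ × List ℚ)}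
    (hcells : CellsOK₂₃ c.base.wL c.base.T c.cells) (h : c.checkROK β R = true)
    {g : ℝ → ℂ} (hg : IsWeilTest g) (hsupp : tsupport g ⊆ Icc (-(c.b : ℝ)) c.b) :
    (β : ℝ) * weilNorm2Sq g ≤ weilTwoPrimeQuadratic g +
      (R.map fun r ↦ (r.1 : ℝ) * ‖∑ k ∈ range (c.base.N + 1),
        ((maskV r k : ℚ) : ℂ) * weilMoment c.base.a0 g k‖ ^ 2).sum := by
  obtain ⟨hsc, hnuchk, hβ, hb0, hb1⟩ := checkROK_spec h
  obtain ⟨-, hbpos, hba, -, -, -, -, hN, -⟩ := scalars_spec hsc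
  have hb0' : (0 : ℝ) < c.b := by exact_mod_cast hbpos
  have hba' : ((c.b : ℚ) : ℝ) ≤ (c.base.a0 : ℝ) := by exact_mod_cast hba
  have ha : (0 : ℝ) < (c.base.a0 : ℝ) := by linarith
  have hsupp' : tsupport g ⊆ Icc (-(c.base.a0 : ℝ)) c.base.a0 := hsupp.trans (Icc_subset_Icc (by linarith) hba')
  have step3 := margin_step3_of_cellsOK hcells hsc hnuchk hg hsupp
  have hbes := weilNorm2Sq_ge_bessel hg ha hsupp' (c.base.N + 1) (c.base.uVec (weilMoment c.base.a0 g))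
  have hcore := WeilCert.core_nonnegR (c := c.base) (nu := c.nuTab) (κ := c.kappaQ - β) R hN hb0 hb1 _ rfl
    (weilMoment c.base.a0 g)
  have hκ' : (0 : ℝ) ≤ ((c.kappaQ - β : ℚ) : ℝ) := by exact_mod_cast sub_nonneg.2 hβ
  have h4 := mul_le_mul_of_nonneg_left hbes hκ'
  push_cast at hcore h4 ⊢
  nlinarith [step3, hcore, h4]

/-- **Soundness of the ODD-SECTOR rank-one augmented two-prime certificate from a valid chain.** If the chain is valid
(`CellsOK₂₃`) and `c.checkR1OK β R = true` (odd block only) then for every ODD test function `g` supported in `[-b, b]`: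
`β ‖g‖₂² ≤ E₂₃(g) + Σ_{(μ,q,c) ∈ R} μ |Σ_{k ≤ N} ĉ_k M_k(g)|²`.  This is the complement certificate `hcert` of the deflated
Temple L-side for the odd sector (`dt_weilOddGroundEnergy_ge_of_ritz`), with polynomial trial vectors
`v_i = Σ_k ĉ_{ik}(x/a₀)^k` on the window. [cite: Yoshida1992, Thm 1 (moment certificates)] -/
theorem weilTwoPrimeQuadratic_rankOne_bound_odd_of_cellsOK {β : ℚ} {R : List (ℚ × ℕ × List ℚ)}
    (hcells : CellsOK₂₃ c.base.wL c.base.T c.cells) (h : c.checkR1OK β R = true)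
    {g : ℝ → ℂ} (hg : IsWeilTest g) (hsupp : tsupport g ⊆ Icc (-(c.b : ℝ)) c.b) (hodd : ∀ x, g (-x) = -g x) :
    (β : ℝ) * weilNorm2Sq g ≤ weilTwoPrimeQuadratic g +
      (R.map fun r ↦ (r.1 : ℝ) * ‖∑ k ∈ range (c.base.N + 1),
        ((maskV r k : ℚ) : ℂ) * weilMoment c.base.a0 g k‖ ^ 2).sum := by
  obtain ⟨hsc, hnuchk, hβ, hb1⟩ := checkR1OK_spec h
  obtain ⟨-, hbpos, hba, -, -, -, -, hN, -⟩ := scalars_spec hsc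
  have hb0' : (0 : ℝ) < c.b := by exact_mod_cast hbpos
  have hba' : ((c.b : ℚ) : ℝ) ≤ (c.base.a0 : ℝ) := by exact_mod_cast hba
  have ha : (0 : ℝ) < (c.base.a0 : ℝ) := by linarith
  have hsupp' : tsupport g ⊆ Icc (-(c.base.a0 : ℝ)) c.base.a0 := hsupp.trans (Icc_subset_Icc (by linarith) hba')
  have step3 := margin_step3_of_cellsOK hcells hsc hnuchk hg hsupp
  have hbes := weilNorm2Sq_ge_bessel hg ha hsupp' (c.base.N + 1) (c.base.uVec (weilMoment c.base.a0 g))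
  have hcore := WeilCert.core_nonnegR_odd (c := c.base) (nu := c.nuTab) (κ := c.kappaQ - β) R hN hb1
    (weilMoment c.base.a0 g) fun i ↦ weilMoment_even_of_odd hodd _ (even_two_mul i)
  have hκ' : (0 : ℝ) ≤ ((c.kappaQ - β : ℚ) : ℝ) := by exact_mod_cast sub_nonneg.2 hβ
  have h4 := mul_le_mul_of_nonneg_left hbes hκ'
  push_cast at hcore h4 ⊢
  nlinarith [step3, hcore, h4]

/-- `checkR` implies `checkROK` (the cell-free part), so the plain soundness theorem is the special case of
`weilTwoPrimeQuadratic_rankOne_bound_of_cellsOK` with the chain certified by the fixed-scale integer checker. [folklore] -/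
theorem checkROK_of_checkR {β : ℚ} {R : List (ℚ × ℕ × List ℚ)} (h : c.checkR β R = true) :
    c.checkROK β R = true := by
  obtain ⟨-, hsc, hnu, hβ, hb0, hb1⟩ := checkR_spec h
  unfold checkROK
  simp only [Bool.and_eq_true, decide_eq_true_eq]
  exact ⟨⟨⟨⟨hsc, hnu⟩, hβ⟩, hb0⟩, hb1⟩

/-- `checkROK` implies `checkR1OK`. [folklore] -/
theorem checkR1OK_of_checkROK {β : ℚ} {R : List (ℚ × ℕ × List ℚ)} (h : c.checkROK β R = true) :
    c.checkR1OK β R = true := by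
  obtain ⟨hsc, hnu, hβ, -, hb1⟩ := checkROK_spec h
  unfold checkR1OK
  simp only [Bool.and_eq_true, decide_eq_true_eq]
  exact ⟨⟨⟨hsc, hnu⟩, hβ⟩, hb1⟩

end WeilCert23

end Literature.NumberTheory.LFunctions

end
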